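import Summits.CriticalPhenomena.PercolationContinuityZ3.Theorems.PercNearOneGluingNoHeavyQuantCountDP
import HarnessLib

/-!
# QUANT lane R8: the SOJOURN LEMMA for independent trials and the all-layer singles chain inequality
# (the law-free core of "FAR holds at every layer on combs")

builds on p205010 (kernel theorem, internal audit signed; external expert review pending)

Support file (`--supports stmt-CriticalPhenomena-4575`), QUANT lane seat prim-quant-p1 (gen 6), rung R8 of
`run/shared/lean/prim/quant/LADDER.md`; memo `run/shared/lean/prim/quant/P1-SURPLUS.md` §17; continues
`…QuantCountDP.lean` (same local notation `PB[p, m] b` = probability that exactly `b` of the first `m` independent trials with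
success probabilities `p 0, p 1, …` succeed).  Pure real algebra; no definitions, no sorries, standard axioms.

**The sojourn lemma** (`Quant.CountDP.sojourn_ge_one`).  Let `ξ₀, ξ₁, …, ξ_{K−1}` be independent Bernoulli(`p k`) trials and
`S_m = ξ₀ + ⋯ + ξ_{m−1}`.  If `p 0 + Σ_{k<K} p k > 2j` (`j ≥ 1`; the FIRST probability counted twice) then
`G_j := Σ_{m=0}^{K} P(S_m = j) ≥ 1`: the success count spends, in expectation, at least one unit of time at level `j`.
(Tight: `(a, 0, …, 0, b, 1)` at `j = 2` has `G₂ = 1 − (1−a)(1−b)` and `2a + b + 1 → 4`.)  Proof: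
* `sojourn_identity` — `G_j + P(S_K ≤ j−1) = 1 + M_j`, `M_j := Σ_{n<K} (1 − p n)·P(S_n = j)` (failure mass examined at level `j`);
* `ponr` — POINT OF NO RETURN: `P(S_{n+j} ≤ j−1) = Σ_{t<j} (1 − p(n+t))·P(S_{n+t} = t)` (the first time the deficit becomes
  unrecoverable; induction on `j` via `cdf_succ`);
* so `G_j − 1 = [M_j(first K−j+1 trials) − P(S_{K−j+1} = 0)] + Σ_{t=1}^{j−1} (1 − p(K−j+t))·[P(S_{K−j+t} = j) − P(S_{K−j+t} = t)]`;
  each bracket of the sum is `≥ 0` because `E S_{K−j+t} ≥ Σ p − (j−t) > j` and the pmf is nondecreasing up to the mean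
  (`PB_mono_of_le_mean`, from `Quant.pb_ratio`); the block is `block_ge_zero`: for `j ≥ 2` its last term alone dominates
  (`PB_level_ge_zero_of_head`, hypothesis `p 0 + Σ_{k≤K−j} p k > j+1`), for `j = 1` the double sum `Σ_n E S_n ≥ 1` does.
* `Quant.CountDP.sojourn_weighted` — **the all-layer singles chain inequality**: weights `w k ≤ 1` with `w k · p k ≥ x` (`0 ≤ x ≤ 1`)
  and `x + Σ_{k<K} w k p k > 2j` give `Σ_{k<K} w k p k · P(S_k = j) + x · P(S_K = j) ≥ x` (`≥ x·G_j ≥ x`);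
  `Quant.CountDP.comb_abel` — Abel summation `Σ_{k<K} (w k − w(k+1))·P(S_{k+1} ≥ j+1) + w K · P(S_K ≥ j) = Σ_{k<K} w k p k P(S_k = j) + w K P(S_K = j)`;
  `Quant.CountDP.comb_far` — hence with `w K = x`: `Σ_{k<K} (w k − w(k+1))·P(S_{k+1} ≥ j+1) + x·P(S_K ≥ j) ≥ x`.
  ON A COMB (a rooted tree in gate coordinates whose relays other than a distinguished argmin relay `a` hang off `a`'s ancestral chain by
  pairwise disjoint private paths, listed root-first with `w k` = probability that the chain is open down to hair `k`'s attachment vertex,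
  `p k` = probability of its private path, `x = P(a reached)`) the left side IS `P(#reached relays ≥ j+1)` and the hypothesis IS FAR's
  `E N > 2j` — so `Quant.FarTreeRow` holds at EVERY layer on combs (the tree bookkeeping is the typer's file; this is the law-free core,
  lead g8 LEAD-NOTES-G8 N19 (2), which conjectured it).  The blob analogue is FALSE (P1-SURPLUS §17: `(4,.9),(1,1),(2,1),(1,.85)`, `j = 4`).
Exact numerical re-check of every step: `work/explore/check_sojourn.py` (seat folder; ≈ 4·10⁵ instance-checks, 0 violations).
Nearest prior art searched (corpus hybrid + vsearch + galaxy, 2026-08-20: "occupation time level Bernoulli process", "sojourn time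
Poisson binomial", "expected number of visits nonhomogeneous Bernoulli", Darroch 1964): nothing found; [this work].
-/

noncomputable section

namespace Summit.CriticalPhenomena.PercolationContinuityZ3.Theorems

namespace Quant

namespace CountDP

open Finset

/-- `PB[p, m] b` = probability that exactly `b` of the first `m` independent trials succeed (recursion on `m`, as in `…QuantCountDP.lean`). -/
local notation3 "PB[" p ", " m "]" =>
  (Nat.rec (motive := fun _ => ℕ → ℝ) (fun b => if b = 0 then (1 : ℝ) else 0)
    (fun n f b => (p : ℕ → ℝ) n * (if b = 0 then (0 : ℝ) else f (b - 1)) + (1 - (p : ℕ → ℝ) n) * f b) (m : ℕ))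

variable (p : ℕ → ℝ)

/-! ### The two identities -/

/-- **Sojourn identity**: `Σ_{m≤K} P(S_m = j) + P(S_K ≤ j−1) = 1 + Σ_{n<K} (1 − p n)·P(S_n = j)` — expected time at level `j`
plus the probability of ending below `j` equals one plus the expected failure mass examined while at level `j`. [this work] -/
theorem sojourn_identity (j : ℕ) : ∀ K : ℕ,
    ∑ m ∈ Finset.range (K + 1), PB[p, m] j + ∑ i ∈ Finset.range j, PB[p, K] i =
      1 + ∑ n ∈ Finset.range K, (1 - p n) * PB[p, n] j := by
  intro K
  induction K with
  | zero =>
    rw [Finset.sum_range_one, Finset.sum_range_zero]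
    cases j with
    | zero => norm_num [PB_zero_zero]
    | succ j =>
      rw [PB_zero_succ, Finset.sum_range_succ', PB_zero_zero]
      simp
  | succ K ih =>
    rw [Finset.sum_range_succ (fun m => PB[p, m] j) (K + 1),
      Finset.sum_range_succ (fun n => (1 - p n) * PB[p, n] j) K]
    cases j with
    | zero =>
      rw [Finset.sum_range_zero] at ih ⊢
      rw [PB_succ_zero]
      linarith
    | succ j =>
      rw [cdf_succ, PB_succ_succ]
      linarith

/-- **Point of no return**: `P(S_{n+j} ≤ j−1) = Σ_{t<j} (1 − p(n+t))·P(S_{n+t} = t)` — a path ending below `j` is classified by the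
first time `n + t` at which the count `t` can no longer reach `j` even if every later trial succeeds (and that trial fails). [this work] -/
theorem ponr (j : ℕ) : ∀ n : ℕ,
    ∑ i ∈ Finset.range j, PB[p, n + j] i = ∑ t ∈ Finset.range j, (1 - p (n + t)) * PB[p, n + t] t := by
  induction j with
  | zero => intro n; simp
  | succ j ih =>
    intro n
    have e : n + (j + 1) = (n + j) + 1 := by omega
    rw [e, cdf_succ, Finset.sum_range_succ, ih n, Finset.sum_range_succ]
    ring

/-! ### The block estimate (`t = 0` term of the point of no return) -/

/-- **Block estimate**: if `p 0 + Σ_{k<K'} p k > j + 1` (`j ≥ 1`) then `P(S_{K'} = 0) ≤ Σ_{n<K'} (1 − p n)·P(S_n = j)`.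
For `j ≥ 2` the last term alone suffices (`PB_level_ge_zero_of_head`); for `j = 1` use `P(S_n = 1) ≥ E S_n · P(S_n = 0)`,
`(1 − p n) P(S_n = 0) = P(S_{n+1} = 0) ≥ P(S_{K'} = 0)` and `Σ_{n<K'} E S_n ≥ 1`. [this work] -/
theorem block_ge_zero (hp : ∀ k, 0 ≤ p k ∧ p k ≤ 1) (j K' : ℕ) (hj : 1 ≤ j)
    (hmean : (j : ℝ) + 1 < p 0 + ∑ k ∈ Finset.range K', p k) :
    PB[p, K'] 0 ≤ ∑ n ∈ Finset.range K', (1 - p n) * PB[p, n] j := by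
  -- `K' ≥ 2`
  have hsumle : ∀ m : ℕ, ∑ k ∈ Finset.range m, p k ≤ m := by
    intro m
    have := Finset.sum_le_sum (s := Finset.range m) (f := p) (g := fun _ => (1 : ℝ)) fun k _ => (hp k).2
    simpa using this
  have hK2 : 2 ≤ K' := by
    by_contra h
    push Not at h
    interval_cases K'
    · simp at hmean; linarith [(hp 0).2, show (1 : ℝ) ≤ j by exact_mod_cast hj]
    · rw [Finset.sum_range_one] at hmean; linarith [(hp 0).2, show (1 : ℝ) ≤ j by exact_mod_cast hj]
  obtain ⟨k, rfl⟩ : ∃ k, K' = k + 2 := ⟨K' - 2, by omega⟩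
  have hterm_nonneg : ∀ n, 0 ≤ (1 - p n) * PB[p, n] j := fun n => mul_nonneg (by linarith [hp n]) (PB_nonneg p hp n j)
  rcases Nat.lt_or_ge j 2 with hj1 | hj2
  · -- `j = 1`
    have hj' : j = 1 := by omega
    subst hj'
    push_cast at hmean
    cases k with
    | zero =>
      -- `K' = 2`: `q₀ q₁ ≤ q₁ p₀` since `p₀ ≥ 1/2`
      rw [Finset.sum_range_succ, Finset.sum_range_one] at hmean
      simp only [Nat.zero_add, Finset.sum_range_succ, Finset.sum_range_zero, PB_zero]
      norm_num
      nlinarith [(hp 0).1, (hp 0).2, (hp 1).1, (hp 1).2]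
    | succ k =>
      -- `K' = k + 3 ≥ 3`: `Σ_n (1−p n) PB[n] 1 ≥ Σ_n μ_n PB[n+1] 0 ≥ PB[K'] 0 · Σ_n μ_n` and `Σ_n μ_n ≥ μ_{k+1} + μ_{k+2} > 1`
      have hstep : ∀ n, n + 1 ≤ k + 1 + 2 →
          (∑ i ∈ Finset.range n, p i) * PB[p, k + 1 + 2] 0 ≤ (1 - p n) * PB[p, n] 1 := by
        intro n hn
        have hlin := PB_ge_linear p hp n 1 le_rfl
        push_cast at hlin
        simp only [sub_add_cancel] at hlin
        have hq : 0 ≤ 1 - p n := by linarith [hp n]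
        have h1 := mul_le_mul_of_nonneg_left hlin hq
        have h2 : PB[p, k + 1 + 2] 0 ≤ PB[p, n + 1] 0 := PB_zero_antitone p hp hn
        have hμ : 0 ≤ ∑ i ∈ Finset.range n, p i := Finset.sum_nonneg fun i _ => (hp i).1
        rw [PB_succ_zero p n] at h2
        have h3 := mul_le_mul_of_nonneg_left h2 hμ
        nlinarith
      -- keep the two top terms `n = k+1` and `n = k+1+1`
      rw [Finset.sum_range_succ, Finset.sum_range_succ]
      have hrest : 0 ≤ ∑ n ∈ Finset.range (k + 1), (1 - p n) * PB[p, n] 1 := Finset.sum_nonneg fun n _ => hterm_nonneg n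
      have ha := hstep (k + 1) (by omega)
      have hb := hstep (k + 1 + 1) (by omega)
      -- the means
      have hμ1 : p 0 ≤ ∑ i ∈ Finset.range (k + 1), p i := by
        rw [Finset.sum_range_succ']
        have : 0 ≤ ∑ i ∈ Finset.range k, p (i + 1) := Finset.sum_nonneg fun i _ => (hp (i + 1)).1
        linarith
      have hμ2 : 1 < p 0 + ∑ i ∈ Finset.range (k + 1 + 1), p i := by
        rw [Finset.sum_range_succ (fun i => p i) (k + 1 + 1)] at hmean
        linarith [(hp (k + 1 + 1)).2]
      have h0 := PB_nonneg p hp (k + 1 + 2) 0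
      have e1 := mul_le_mul_of_nonneg_right hμ1 h0
      have e2 := mul_le_mul_of_nonneg_right hμ2.le h0
      nlinarith
  · -- `j ≥ 2`: the last term alone
    rw [Finset.sum_range_succ, PB_succ_zero]
    have hrest : 0 ≤ ∑ n ∈ Finset.range (k + 1), (1 - p n) * PB[p, n] j := Finset.sum_nonneg fun n _ => hterm_nonneg n
    have hmean' : (j : ℝ) < p 0 + ∑ i ∈ Finset.range (k + 1), p i := by
      rw [Finset.sum_range_succ] at hmean
      linarith [(hp (k + 1)).2]
    have hlev := PB_level_ge_zero_of_head p hp (k + 1) j hj2 (by omega) hmean'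
    have hq : 0 ≤ 1 - p (k + 1) := by linarith [hp (k + 1)]
    nlinarith [mul_le_mul_of_nonneg_left hlev hq]

/-! ### The sojourn lemma -/

/-- **THE SOJOURN LEMMA.**  For independent Bernoulli(`p k`) trials (`0 ≤ p k ≤ 1`) with `p 0 + Σ_{k<K} p k > 2j`, `j ≥ 1`:
`Σ_{m=0}^{K} P(S_m = j) ≥ 1` — the expected number of times `m ∈ [0, K]` at which exactly `j` of the first `m` trials have succeeded
is at least one.  (Only the first probability is counted twice; the threshold `2j` is sharp.) [this work] -/
theorem sojourn_ge_one (hp : ∀ k, 0 ≤ p k ∧ p k ≤ 1) (K j : ℕ) (hj : 1 ≤ j)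
    (hmean : (2 * j : ℝ) < p 0 + ∑ k ∈ Finset.range K, p k) :
    1 ≤ ∑ m ∈ Finset.range (K + 1), PB[p, m] j := by
  have hsumle : ∀ m : ℕ, ∑ k ∈ Finset.range m, p k ≤ m := by
    intro m
    have := Finset.sum_le_sum (s := Finset.range m) (f := p) (g := fun _ => (1 : ℝ)) fun k _ => (hp k).2
    simpa using this
  -- `K ≥ 2j`; write `j = j' + 1`, `K = n₀ + 1 + j'` with `n₀ = K − j`
  have hK : 2 * j ≤ K := by
    have h1 : (2 * j : ℝ) < 1 + K := by linarith [hsumle K, (hp 0).2]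
    have h2 : ((2 * j : ℕ) : ℝ) < ((K + 1 : ℕ) : ℝ) := by push_cast; linarith
    have h3 : 2 * j < K + 1 := by exact_mod_cast h2
    omega
  obtain ⟨j', rfl⟩ : ∃ j', j = j' + 1 := ⟨j - 1, by omega⟩
  obtain ⟨n₀, rfl⟩ : ∃ n₀, K = n₀ + 1 + j' := ⟨K - (j' + 1), by omega⟩
  -- sojourn identity: enough to bound the cdf by the failure mass
  have hid := sojourn_identity p (j' + 1) (n₀ + 1 + j')
  suffices hmain : ∑ i ∈ Finset.range (j' + 1), PB[p, n₀ + 1 + j'] i ≤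
      ∑ n ∈ Finset.range (n₀ + 1 + j'), (1 - p n) * PB[p, n] (j' + 1) by linarith
  -- point of no return at `n = n₀`
  have hponr := ponr p (j' + 1) n₀
  rw [show n₀ + (j' + 1) = n₀ + 1 + j' by omega] at hponr
  rw [hponr, Finset.sum_range_succ' _ j', Finset.sum_range_add]
  simp only [Nat.add_zero]
  -- (a) the block (`t = 0` term)
  have hblock : (1 - p n₀) * PB[p, n₀] 0 ≤ ∑ n ∈ Finset.range (n₀ + 1), (1 - p n) * PB[p, n] (j' + 1) := by
    rw [← PB_succ_zero]
    refine block_ge_zero p hp (j' + 1) (n₀ + 1) (by omega) ?_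
    have hsplit := Finset.sum_range_add p (n₀ + 1) j'
    have hle : ∑ x ∈ Finset.range j', p (n₀ + 1 + x) ≤ j' := by
      have := Finset.sum_le_sum (s := Finset.range j') (f := fun x => p (n₀ + 1 + x)) (g := fun _ => (1 : ℝ))
        fun x _ => (hp _).2
      simpa using this
    push_cast at hmean ⊢
    linarith
  -- (b) the terms `t = 1, …, j'`: the pmf at `t` is below the pmf at `j'+1 ≤ mean`
  have hterms : ∀ t ∈ Finset.range j',
      (1 - p (n₀ + (t + 1))) * PB[p, n₀ + (t + 1)] (t + 1) ≤ (1 - p (n₀ + 1 + t)) * PB[p, n₀ + 1 + t] (j' + 1) := by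
    intro t ht
    rw [Finset.mem_range] at ht
    rw [show n₀ + (t + 1) = n₀ + 1 + t by omega]
    have hq : 0 ≤ 1 - p (n₀ + 1 + t) := by linarith [hp (n₀ + 1 + t)]
    refine mul_le_mul_of_nonneg_left (PB_mono_of_le_mean p hp (n₀ + 1 + t) (t + 1) (j' + 1) (by omega) ?_) hq
    -- the mean of the first `n₀ + 1 + t` trials is `> j' + 1`
    have hsplit := Finset.sum_range_add p (n₀ + 1 + t) (j' - t)
    rw [show n₀ + 1 + t + (j' - t) = n₀ + 1 + j' by omega] at hsplit
    have hle : ∑ x ∈ Finset.range (j' - t), p (n₀ + 1 + t + x) ≤ ((j' - t : ℕ) : ℝ) := by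
      have := Finset.sum_le_sum (s := Finset.range (j' - t)) (f := fun x => p (n₀ + 1 + t + x)) (g := fun _ => (1 : ℝ))
        fun x _ => (hp _).2
      simpa using this
    have hcast : ((j' - t : ℕ) : ℝ) = (j' : ℝ) - t := by
      rw [Nat.cast_sub (by omega)]
    push_cast at hmean ⊢
    rw [hcast] at hle
    have ht0 : (0 : ℝ) ≤ t := Nat.cast_nonneg t
    linarith [(hp 0).2]
  have hsum := Finset.sum_le_sum hterms
  linarith

/-! ### The all-layer singles chain inequality (comb form) -/

/-- **Weighted form (all-layer singles chain inequality).**  Weights `w k ≤ 1` with `x ≤ w k · p k` (`0 ≤ x ≤ 1`, `0 ≤ p k ≤ 1`) and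
`x + Σ_{k<K} w k · p k > 2j` (`j ≥ 1`) give `x ≤ Σ_{k<K} w k · p k · P(S_k = j) + x · P(S_K = j)` — because the right side is
`≥ x · Σ_{m≤K} P(S_m = j) ≥ x` by the sojourn lemma (`p 0 + Σ p ≥ x + Σ w p`). [this work] -/
theorem sojourn_weighted (hp : ∀ k, 0 ≤ p k ∧ p k ≤ 1) (w : ℕ → ℝ) (x : ℝ) (K j : ℕ) (hj : 1 ≤ j)
    (hx0 : 0 ≤ x) (hx1 : x ≤ 1) (hw1 : ∀ k, k < K → w k ≤ 1) (hwx : ∀ k, k < K → x ≤ w k * p k)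
    (hmean : (2 * j : ℝ) < x + ∑ k ∈ Finset.range K, w k * p k) :
    x ≤ ∑ k ∈ Finset.range K, w k * p k * PB[p, k] j + x * PB[p, K] j := by
  -- `K ≥ 1`, so `p 0 ≥ w 0 p 0 ≥ x`
  have hK : 1 ≤ K := by
    by_contra h
    have hK0 : K = 0 := by omega
    subst hK0
    rw [Finset.sum_range_zero] at hmean
    have : (1 : ℝ) ≤ j := by exact_mod_cast hj
    linarith
  have hwp_le : ∀ k, k < K → w k * p k ≤ p k := by
    intro k hk
    have := hw1 k hk
    nlinarith [(hp k).1]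
  have hmean' : (2 * j : ℝ) < p 0 + ∑ k ∈ Finset.range K, p k := by
    have h1 : ∑ k ∈ Finset.range K, w k * p k ≤ ∑ k ∈ Finset.range K, p k :=
      Finset.sum_le_sum fun k hk => hwp_le k (Finset.mem_range.1 hk)
    have h2 : x ≤ p 0 := (hwx 0 (by omega)).trans (hwp_le 0 (by omega))
    linarith
  have hG := sojourn_ge_one p hp K j hj hmean'
  -- `Σ w p PB ≥ x Σ PB`
  have hdom : ∑ k ∈ Finset.range K, x * PB[p, k] j ≤ ∑ k ∈ Finset.range K, w k * p k * PB[p, k] j :=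
    Finset.sum_le_sum fun k hk => mul_le_mul_of_nonneg_right (hwx k (Finset.mem_range.1 hk)) (PB_nonneg p hp k j)
  rw [← Finset.mul_sum] at hdom
  rw [Finset.sum_range_succ] at hG
  have hKnn := PB_nonneg p hp K j
  nlinarith

/-- **Abel summation for the comb functional.**  For any weights `w`:
`Σ_{k<K} (w k − w(k+1))·P(S_{k+1} ≥ j+1) + w K·P(S_K ≥ j) = Σ_{k<K} w k · p k · P(S_k = j) + w K · P(S_K = j)`
(tails written as `1 −` cdf sums).  On a comb with `w K = x` the left side is `P(at least j+1 relays reached)`. [this work] -/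
theorem comb_abel (w : ℕ → ℝ) (j : ℕ) : ∀ K : ℕ,
    ∑ k ∈ Finset.range K, (w k - w (k + 1)) * (1 - ∑ i ∈ Finset.range (j + 1), PB[p, k + 1] i) +
        w K * (1 - ∑ i ∈ Finset.range j, PB[p, K] i) =
      ∑ k ∈ Finset.range K, w k * p k * PB[p, k] j + w K * PB[p, K] j := by
  intro K
  induction K with
  | zero =>
    rw [Finset.sum_range_zero, Finset.sum_range_zero]
    cases j with
    | zero => rw [Finset.sum_range_zero, PB_zero_zero]; ring
    | succ j =>
      rw [PB_zero_succ, Finset.sum_range_succ', PB_zero_zero]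
      simp only [PB_zero_succ, Finset.sum_const_zero]
      ring
  | succ K ih =>
    rw [Finset.sum_range_succ (fun k => (w k - w (k + 1)) * (1 - ∑ i ∈ Finset.range (j + 1), PB[p, k + 1] i)) K,
      Finset.sum_range_succ (fun k => w k * p k * PB[p, k] j) K]
    have h1 := cdf_succ p K j
    have h2 := Finset.sum_range_succ (fun i => PB[p, K] i) j
    have h3 := Finset.sum_range_succ (fun i => PB[p, K + 1] i) j
    linear_combination ih - (w K) * h1 - (w K) * h2 + (w (K + 1)) * h3

/-- **FAR on combs, law-free form.**  Weights `w 0, …, w K` with `w k ≤ 1`, `x ≤ w k · p k` (`k < K`), `w K = x ∈ [0,1]`, and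
`x + Σ_{k<K} w k · p k > 2j` (`j ≥ 1`) give
`Σ_{k<K} (w k − w(k+1))·P(S_{k+1} ≥ j+1) + x·P(S_K ≥ j) ≥ x`.
With `w` the (nonincreasing) chain-prefix weights of a comb and `x = P(a reached)` this is the instance of `Quant.FarTreeRow` /
`Quant.FarRelayRow` at layer `j` for that comb: `P(N ≥ j+1) ≥ min_b P(b reached)` whenever `E N > 2j`. [this work] -/
theorem comb_far (hp : ∀ k, 0 ≤ p k ∧ p k ≤ 1) (w : ℕ → ℝ) (x : ℝ) (K j : ℕ) (hj : 1 ≤ j)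
    (hx0 : 0 ≤ x) (hx1 : x ≤ 1) (hw1 : ∀ k, k < K → w k ≤ 1) (hwx : ∀ k, k < K → x ≤ w k * p k) (hwK : w K = x)
    (hmean : (2 * j : ℝ) < x + ∑ k ∈ Finset.range K, w k * p k) :
    x ≤ ∑ k ∈ Finset.range K, (w k - w (k + 1)) * (1 - ∑ i ∈ Finset.range (j + 1), PB[p, k + 1] i) +
        x * (1 - ∑ i ∈ Finset.range j, PB[p, K] i) := by
  have h := comb_abel p w j K
  rw [hwK] at h
  rw [h]
  exact sojourn_weighted p hp w x K j hj hx0 hx1 hw1 hwx hmean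

/-! ### The comb recursion in closed form (removing the top hair) -/

/-- **Top-hair recursion, threshold one.**  With `Ψ₁(p, w, x, K) := Σ_{k<K} w k p k · PB[p, k] 0 + x · PB[p, K] 0`:
`Ψ₁(p, w, x, K+1) = w 0 · p 0 + (1 − p 0) · Ψ₁(p∘succ, w∘succ, x, K)` (head split of the recursion). [this work] -/
theorem psi_succ_one (w : ℕ → ℝ) (x : ℝ) (K : ℕ) :
    ∑ k ∈ Finset.range (K + 1), w k * p k * PB[p, k] 0 + x * PB[p, K + 1] 0 =
      w 0 * p 0 + (1 - p 0) * (∑ k ∈ Finset.range K, w (k + 1) * p (k + 1) * PB[(fun k => p (k + 1)), k] 0 +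
        x * PB[(fun k => p (k + 1)), K] 0) := by
  rw [Finset.sum_range_succ', PB_zero_zero, PB_head_zero]
  have h : ∀ k, PB[p, k + 1] 0 = (1 - p 0) * PB[(fun k => p (k + 1)), k] 0 := fun k => PB_head_zero p k
  have hs : ∑ k ∈ Finset.range K, w (k + 1) * p (k + 1) * PB[p, k + 1] 0 =
      (1 - p 0) * ∑ k ∈ Finset.range K, w (k + 1) * p (k + 1) * PB[(fun k => p (k + 1)), k] 0 := by
    rw [Finset.mul_sum]
    exact Finset.sum_congr rfl fun k _ => by rw [h k]; ring
  rw [hs]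
  ring

/-- **Top-hair recursion, higher thresholds.**  With `Ψ_{i+1}(p, w, x, K) := Σ_{k<K} w k p k · PB[p, k] i + x · PB[p, K] i`:
`Ψ_{i+2}(p, w, x, K+1) = p 0 · Ψ_{i+1}(p∘succ, w∘succ, x, K) + (1 − p 0) · Ψ_{i+2}(p∘succ, w∘succ, x, K)`. [this work] -/
theorem psi_succ_succ (w : ℕ → ℝ) (x : ℝ) (K i : ℕ) :
    ∑ k ∈ Finset.range (K + 1), w k * p k * PB[p, k] (i + 1) + x * PB[p, K + 1] (i + 1) =
      p 0 * (∑ k ∈ Finset.range K, w (k + 1) * p (k + 1) * PB[(fun k => p (k + 1)), k] i +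
          x * PB[(fun k => p (k + 1)), K] i) +
        (1 - p 0) * (∑ k ∈ Finset.range K, w (k + 1) * p (k + 1) * PB[(fun k => p (k + 1)), k] (i + 1) +
          x * PB[(fun k => p (k + 1)), K] (i + 1)) := by
  rw [Finset.sum_range_succ', PB_zero_succ, PB_head_succ]
  have h : ∀ k, PB[p, k + 1] (i + 1) =
      p 0 * PB[(fun k => p (k + 1)), k] i + (1 - p 0) * PB[(fun k => p (k + 1)), k] (i + 1) := fun k => PB_head_succ p k i
  have hs : ∑ k ∈ Finset.range K, w (k + 1) * p (k + 1) * PB[p, k + 1] (i + 1) =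
      p 0 * ∑ k ∈ Finset.range K, w (k + 1) * p (k + 1) * PB[(fun k => p (k + 1)), k] i +
        (1 - p 0) * ∑ k ∈ Finset.range K, w (k + 1) * p (k + 1) * PB[(fun k => p (k + 1)), k] (i + 1) := by
    rw [Finset.mul_sum, Finset.mul_sum, ← Finset.sum_add_distrib]
    exact Finset.sum_congr rfl fun k _ => by rw [h k]; ring
  rw [hs]
  ring

end CountDP

end Quant

end Summit.CriticalPhenomena.PercolationContinuityZ3.Theorems

end
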